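import Mathlib.NumberTheory.LSeries.DirichletContinuation
import Mathlib.NumberTheory.LSeries.Nonvanishing
import Mathlib.Analysis.SpecialFunctions.Complex.LogBounds
import Mathlib.Analysis.SpecialFunctions.Complex.Arg
import HarnessLib

/-!
# `L(χ, 0) = -B_{1,χ} ≠ 0` for odd primitive Dirichlet characters

Support file I (everything PROVED; no named facts, no `sorry`) for the discharge of the named fact
`Literature.NumberTheory.Transcendental.deligne_gammaMonomial_algebraic` (algebraicity of
Γ-monomials of Hodge type; Deligne, LNM 900, Thm. 7.15/7.18; elementary proof by Koblitz–Ogus,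
appendix to Deligne, PSPM 33.2 (1979), via Kubert–Lang distributions). The Koblitz–Ogus argument
needs exactly one arithmetic input: **`B_{1,χ} = (1/f) ∑_{a mod f} χ(a) a ≠ 0` for every odd
primitive character `χ`** (equivalently `L(1, χ̄) ≠ 0`). Mathlib has `L(1, χ) ≠ 0`
(`DirichletCharacter.LFunction_apply_one_ne_zero`) and the functional equation
(`IsPrimitive.completedLFunction_one_sub`), hence `L(0, χ) ≠ 0` for odd primitive `χ`
(`LFunction_apply_zero_ne_zero`); what it lacks is the VALUE `L(0, χ) = -B_{1,χ}`, i.e. the value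
`ζ_odd(x, 0) = 1/2 - x` of the odd Hurwitz zeta function (the case `k = 0` of
`HurwitzZeta.hurwitzZeta_neg_nat` is an explicit TODO there). We supply it:

* `expZeta_one` : `∑_{n ≥ 1} e^{2πina} n^{-s} |_{s=1} = expZeta a 1 = -log (1 - e^{2πia})` for
  `e^{2πia} ≠ 1`. Proof: Abel summation `∑_{n ≤ M} zⁿ n^{-σ} = G_M M^{-σ} + ∑_{n<M} G_n (n^{-σ} -
  (n+1)^{-σ})` (`abel_summation`, `G_n = z + ⋯ + zⁿ` bounded), so for `σ ∈ [1, 2]` the partial sums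
  converge to the absolutely convergent `T(z, σ) = ∑ G_{n+1}((n+1)^{-σ} - (n+2)^{-σ})`, continuous
  on `[1, 2]` (M-test); `T(z, σ) = expZeta a σ` for `σ > 1` (Mathlib's Dirichlet series), hence at
  `σ = 1` by continuity; and `T(z, 1) = ∑ G_{n+1}/((n+1)(n+2)) = (z/(z-1))(F(z) - 1)` with
  `F(w) = ∑ w^{n+1}/((n+1)(n+2)) = 1 + ((1-w)/w) log(1-w)`, an ABSOLUTELY convergent power series
  on the closed disc (Mercator series inside, radial continuity up to the boundary).
* `sinZeta_one` : `sinZeta a 1 = π(1/2 - a)` (`0 < a < 1`), as `-arg(1 - e^{2πia})`.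
* `hurwitzZetaOdd_zero` : `hurwitzZetaOdd a 0 = 1/2 - a` (`0 < a < 1`).
* `LFunction_apply_zero_of_odd` : `L(χ, 0) = -(1/N) ∑_{j mod N} χ(j) j` for odd `χ` mod `N`.
* `LFunction_apply_zero_ne_zero`, `sum_char_mul_val_ne_zero` : for odd primitive `χ`,
  `L(χ, 0) ≠ 0` and `∑ χ(j) j ≠ 0`.

References: standard (e.g. Washington, *Cyclotomic Fields*, Thm. 4.2 and Ch. 4; Lang,
*Cyclotomic Fields I–II*, Ch. 2 §2). All statements here are [folklore].
-/

noncomputable section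

open Complex Filter Topology Finset

namespace Literature.NumberTheory.Transcendental

namespace KoblitzOgus

/-! ### Abel summation for `∑ zⁿ wₙ` -/

-- This file introduces no definitions and no notation; the recurring expressions are
-- `G_n(z) = ∑_{k<n} z^{k+1}` (geometric partial sums), `c_n = 1/((n+1)(n+2))`,
-- `F(w) = ∑ w^{n+1} c_n`, the weights `k^{-σ}` (real power, cast to `ℂ`) and
-- `T(z, σ) = ∑_n G_{n+1}(z) ((n+1)^{-σ} - (n+2)^{-σ})`, always written out in full.

/-- Closed form `G_n = z (zⁿ - 1)/(z - 1)` for `z ≠ 1`. [folklore] -/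
theorem geomTail_eq (z : ℂ) (hz : z ≠ 1) (n : ℕ) :
    (∑ k ∈ Finset.range (n), (z) ^ (k + 1)) = z * (z ^ n - 1) / (z - 1) := by
  have : ∑ k ∈ range n, z ^ (k + 1) = z * ∑ k ∈ range n, z ^ k := by
    rw [mul_sum]; refine sum_congr rfl fun k _ => by ring
  rw [this, geom_sum_eq hz, mul_div_assoc]

/-- `‖G_n‖ ≤ 2 / ‖z - 1‖` when `‖z‖ ≤ 1`, `z ≠ 1`. [folklore] -/
theorem norm_geomTail_le {z : ℂ} (hz1 : ‖z‖ ≤ 1) (hz : z ≠ 1) (n : ℕ) :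
    ‖(∑ k ∈ Finset.range (n), (z) ^ (k + 1))‖ ≤ 2 / ‖z - 1‖ := by
  have hz' : 0 < ‖z - 1‖ := norm_pos_iff.mpr (sub_ne_zero.mpr hz)
  rw [geomTail_eq z hz, norm_div, norm_mul]
  apply div_le_div_of_nonneg_right _ hz'.le
  have h1 : ‖z ^ n - 1‖ ≤ 2 := by
    calc ‖z ^ n - 1‖ ≤ ‖z ^ n‖ + ‖(1 : ℂ)‖ := norm_sub_le _ _
      _ ≤ 1 + 1 := by
          gcongr
          · rw [norm_pow]; exact pow_le_one₀ (norm_nonneg _) hz1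
          · simp
      _ = 2 := by norm_num
  calc ‖z‖ * ‖z ^ n - 1‖ ≤ 1 * 2 := by gcongr
    _ = 2 := by ring

/-- **Abel summation**: `∑_{n<M} z^{n+1} w_{n+1} = G_M w_M + ∑_{n<M} G_n (w_n - w_{n+1})`.
[folklore] -/
theorem abel_summation (z : ℂ) (w : ℕ → ℂ) (M : ℕ) :
    ∑ n ∈ range M, z ^ (n + 1) * w (n + 1) =
      (∑ k ∈ Finset.range (M), (z) ^ (k + 1)) * w M + ∑ n ∈ range M, (∑ k ∈ Finset.range (n), (z) ^ (k + 1)) * (w n - w (n + 1)) := by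
  induction M with
  | zero => simp
  | succ M ih =>
    rw [sum_range_succ, ih]
    simp only [sum_range_succ]
    ring

/-! ### The weights `n^{-σ}` -/

/-- Bernoulli-type inequality: `(n+1)^{-σ} ≥ n^{-σ} (1 - σ/n)` for `n > 0`, `σ ≥ 0`; in the form
`n^{-σ} - (n+1)^{-σ} ≤ σ n^{-σ} / n`. [folklore] -/
theorem rpow_neg_sub_succ_le {σ : ℝ} (hσ : 0 ≤ σ) {x : ℝ} (hx : 0 < x) :
    x ^ (-σ) - (x + 1) ^ (-σ) ≤ σ * x ^ (-σ) / x := by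
  have hx1 : 0 < x + 1 := by linarith
  -- `(x+1)^{-σ} = x^{-σ} (1 + 1/x)^{-σ}`
  have hsplit : (x + 1) ^ (-σ) = x ^ (-σ) * (1 + 1 / x) ^ (-σ) := by
    rw [← Real.mul_rpow hx.le (by positivity)]
    congr 1
    field_simp
  -- `(1 + 1/x)^{-σ} ≥ 1 - σ/x`
  have hbern : 1 - σ / x ≤ (1 + 1 / x) ^ (-σ) := by
    have hpos : 0 < 1 + 1 / x := by positivity
    rw [Real.rpow_def_of_pos hpos]
    have hlog : Real.log (1 + 1 / x) ≤ 1 / x := by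
      have := Real.log_le_sub_one_of_pos hpos
      linarith
    calc 1 - σ / x = -(σ * (1 / x)) + 1 := by ring
      _ ≤ -(σ * Real.log (1 + 1 / x)) + 1 := by
          have : σ * Real.log (1 + 1 / x) ≤ σ * (1 / x) := mul_le_mul_of_nonneg_left hlog hσ
          linarith
      _ ≤ Real.exp (-(σ * Real.log (1 + 1 / x))) := Real.add_one_le_exp _
      _ = Real.exp (Real.log (1 + 1 / x) * -σ) := by ring_nf
  have hxσ : 0 ≤ x ^ (-σ) := Real.rpow_nonneg hx.le _
  calc x ^ (-σ) - (x + 1) ^ (-σ) = x ^ (-σ) * (1 - (1 + 1 / x) ^ (-σ)) := by rw [hsplit]; ring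
    _ ≤ x ^ (-σ) * (σ / x) := by
        apply mul_le_mul_of_nonneg_left _ hxσ
        linarith
    _ = σ * x ^ (-σ) / x := by ring

/-- For `σ ∈ [1, 2]` and `n ≥ 1`: `0 ≤ n^{-σ} - (n+1)^{-σ} ≤ 2 / n²`. [folklore] -/
theorem rpow_neg_sub_succ_le_two_div_sq {σ : ℝ} (hσ : σ ∈ Set.Icc (1 : ℝ) 2) (n : ℕ) (hn : 0 < n) :
    (n : ℝ) ^ (-σ) - ((n : ℝ) + 1) ^ (-σ) ≤ 2 / (n : ℝ) ^ 2 := by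
  have hn' : (0 : ℝ) < n := by exact_mod_cast hn
  have hn1 : (1 : ℝ) ≤ n := by exact_mod_cast hn
  have h1 := rpow_neg_sub_succ_le (by linarith [hσ.1] : (0 : ℝ) ≤ σ) hn'
  have h2 : (n : ℝ) ^ (-σ) ≤ (n : ℝ) ^ (-1 : ℝ) :=
    Real.rpow_le_rpow_of_exponent_le hn1 (by linarith [hσ.1])
  have h3 : (n : ℝ) ^ (-1 : ℝ) = 1 / n := by
    rw [Real.rpow_neg hn'.le, Real.rpow_one, one_div]
  calc (n : ℝ) ^ (-σ) - ((n : ℝ) + 1) ^ (-σ) ≤ σ * (n : ℝ) ^ (-σ) / n := h1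
    _ ≤ 2 * (1 / n) / n := by
        gcongr
        · exact hσ.2
        · rwa [h3] at h2
    _ = 2 / (n : ℝ) ^ 2 := by field_simp

/-- Monotonicity: `0 ≤ n^{-σ} - (n+1)^{-σ}` for `σ ≥ 0`, `n > 0`. [folklore] -/
theorem rpow_neg_sub_succ_nonneg {σ : ℝ} (hσ : 0 ≤ σ) {x : ℝ} (hx : 0 < x) :
    0 ≤ x ^ (-σ) - (x + 1) ^ (-σ) := by
  have := Real.rpow_le_rpow_of_nonpos hx (by linarith : x ≤ x + 1) (by linarith : -σ ≤ 0)
  linarith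


/-! ### The power series `F(w) = ∑ w^{n+1} / ((n+1)(n+2))` on the closed unit disc -/

/-- `1/((n+1)(n+2)) = 1/(n+1) - 1/(n+2)`. [folklore] -/
theorem Fcoef_eq_sub (n : ℕ) : ((1 : ℝ) / ((((n : ℕ) : ℝ) + 1) * (((n : ℕ) : ℝ) + 2)) : ℝ) = 1 / ((n : ℝ) + 1) - 1 / ((n : ℝ) + 2) := by
  field_simp
  ring

/-- `0 ≤ 1/((n+1)(n+2))`. [folklore] -/
theorem Fcoef_nonneg (n : ℕ) : 0 ≤ ((1 : ℝ) / ((((n : ℕ) : ℝ) + 1) * (((n : ℕ) : ℝ) + 2)) : ℝ) := by positivity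

/-- `1/((n+1)(n+2)) ≤ 1`. [folklore] -/
theorem Fcoef_le_one (n : ℕ) : ((1 : ℝ) / ((((n : ℕ) : ℝ) + 1) * (((n : ℕ) : ℝ) + 2)) : ℝ) ≤ 1 := by
  rw [div_le_one (by positivity)]
  nlinarith [(Nat.cast_nonneg n : (0:ℝ) ≤ n)]

/-- Telescoping: `∑ 1/((n+1)(n+2)) = 1`. [folklore] -/
theorem hasSum_Fcoef : HasSum (fun n : ℕ => ((1 : ℝ) / ((((n : ℕ) : ℝ) + 1) * (((n : ℕ) : ℝ) + 2)) : ℝ)) 1 := by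
  have h : ∀ M : ℕ, ∑ n ∈ range M, ((1 : ℝ) / ((((n : ℕ) : ℝ) + 1) * (((n : ℕ) : ℝ) + 2)) : ℝ) = 1 - 1 / ((M : ℝ) + 1) := by
    intro M
    induction M with
    | zero => simp
    | succ M ih =>
      rw [sum_range_succ, ih, Fcoef_eq_sub]
      push_cast
      ring
  rw [hasSum_iff_tendsto_nat_of_nonneg Fcoef_nonneg, funext h]
  have h2 : Tendsto (fun M : ℕ => (1 : ℝ) - 1 / ((M : ℝ) + 1)) atTop (𝓝 (1 - 0)) :=
    tendsto_const_nhds.sub tendsto_one_div_add_atTop_nhds_zero_nat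
  simpa using h2

/-- The coefficients as complex numbers. [folklore] -/
theorem Fcoef_cast (n : ℕ) : ((((1 : ℝ) / ((((n : ℕ) : ℝ) + 1) * (((n : ℕ) : ℝ) + 2)) : ℝ) : ℝ) : ℂ) = 1 / (((n : ℂ) + 1) * ((n : ℂ) + 2)) := by
  push_cast; rfl

/-- Term bound on the closed disc. [folklore] -/
theorem norm_Fser_term_le {w : ℂ} (hw : ‖w‖ ≤ 1) (n : ℕ) :
    ‖w ^ (n + 1) * (((1 : ℝ) / ((((n : ℕ) : ℝ) + 1) * (((n : ℕ) : ℝ) + 2)) : ℝ) : ℂ)‖ ≤ ((1 : ℝ) / ((((n : ℕ) : ℝ) + 1) * (((n : ℕ) : ℝ) + 2)) : ℝ) := by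
  rw [norm_mul, Complex.norm_real, Real.norm_of_nonneg (Fcoef_nonneg n), norm_pow]
  calc ‖w‖ ^ (n + 1) * ((1 : ℝ) / ((((n : ℕ) : ℝ) + 1) * (((n : ℕ) : ℝ) + 2)) : ℝ) ≤ 1 * ((1 : ℝ) / ((((n : ℕ) : ℝ) + 1) * (((n : ℕ) : ℝ) + 2)) : ℝ) :=
        mul_le_mul_of_nonneg_right (pow_le_one₀ (norm_nonneg _) hw) (Fcoef_nonneg n)
    _ = ((1 : ℝ) / ((((n : ℕ) : ℝ) + 1) * (((n : ℕ) : ℝ) + 2)) : ℝ) := one_mul _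

/-- `F` is continuous on the closed unit disc (Weierstrass M-test). [folklore] -/
theorem continuousOn_Fser : ContinuousOn (fun w : ℂ => (∑' n : ℕ, ((w) : ℂ) ^ (n + 1) * ((((1 : ℝ) / ((((n : ℕ) : ℝ) + 1) * (((n : ℕ) : ℝ) + 2)) : ℝ) : ℝ) : ℂ))) (Metric.closedBall 0 1) := by
  refine continuousOn_tsum (fun n => ?_) hasSum_Fcoef.summable fun n w hw => ?_
  · fun_prop
  · exact norm_Fser_term_le (by simpa using hw) n

/-- Inside the disc: `F(w) = 1 + ((1-w)/w) log(1-w)` for `0 < ‖w‖ < 1` (Mercator series).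
[folklore] -/
theorem hasSum_Fser_of_norm_lt_one {w : ℂ} (hw : ‖w‖ < 1) (hw0 : w ≠ 0) :
    HasSum (fun n : ℕ => w ^ (n + 1) * (((1 : ℝ) / ((((n : ℕ) : ℝ) + 1) * (((n : ℕ) : ℝ) + 2)) : ℝ) : ℂ)) (1 + (1 - w) / w * log (1 - w)) := by
  have h := hasSum_taylorSeries_neg_log hw
  have h1 : HasSum (fun n : ℕ => w ^ (n + 1) / ((n : ℂ) + 1)) (-log (1 - w)) := by
    have := (hasSum_nat_add_iff' 1).mpr h
    simpa using this
  have h2 : HasSum (fun n : ℕ => w ^ (n + 2) / ((n : ℂ) + 2)) (-log (1 - w) - w) := by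
    have := (hasSum_nat_add_iff' 2).mpr h
    simpa [sum_range_succ, add_assoc, one_add_one_eq_two] using this
  have h3 := h1.sub (h2.mul_left w⁻¹)
  have hfun : (fun n : ℕ => w ^ (n + 1) * (((1 : ℝ) / ((((n : ℕ) : ℝ) + 1) * (((n : ℕ) : ℝ) + 2)) : ℝ) : ℂ)) =
      fun n : ℕ => w ^ (n + 1) / ((n : ℂ) + 1) - w⁻¹ * (w ^ (n + 2) / ((n : ℂ) + 2)) := by
    funext n
    have hn1 : (n : ℂ) + 1 ≠ 0 := Nat.cast_add_one_ne_zero n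
    have hn2 : (n : ℂ) + 2 ≠ 0 := by
      have : (n : ℂ) + 2 = ((n + 1 : ℕ) : ℂ) + 1 := by push_cast; ring
      rw [this]; exact Nat.cast_add_one_ne_zero _
    rw [Fcoef_cast]
    field_simp
    ring
  have hval : 1 + (1 - w) / w * log (1 - w) = -log (1 - w) - w⁻¹ * (-log (1 - w) - w) := by
    field_simp
    ring
  rw [hfun, hval]
  exact h3

/-- `1 - z` lies in the slit plane when `‖z‖ ≤ 1`, `z ≠ 1`. [folklore] -/
theorem one_sub_mem_slitPlane {z : ℂ} (hz1 : ‖z‖ ≤ 1) (hz : z ≠ 1) : 1 - z ∈ slitPlane := by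
  rw [mem_slitPlane_iff]
  by_cases him : z.im = 0
  · left
    have hre : |z.re| ≤ 1 := (abs_re_le_norm z).trans hz1
    have hne : z.re ≠ 1 := by
      intro h
      apply hz
      apply Complex.ext <;> simp [h, him]
    simp only [sub_re, one_re]
    have := (abs_le.mp hre).2
    exact sub_pos.mpr (lt_of_le_of_ne this hne)
  · right
    simpa using him

/-- On the boundary: `F(z) = 1 + ((1-z)/z) log(1-z)` for `‖z‖ = 1`, `z ≠ 1` (radial limit of the
interior identity; both sides are continuous up to the boundary point). [folklore] -/
theorem Fser_eq_of_norm_eq_one {z : ℂ} (hz1 : ‖z‖ = 1) (hz : z ≠ 1) :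
    (∑' n : ℕ, ((z) : ℂ) ^ (n + 1) * ((((1 : ℝ) / ((((n : ℕ) : ℝ) + 1) * (((n : ℕ) : ℝ) + 2)) : ℝ) : ℝ) : ℂ)) = 1 + (1 - z) / z * log (1 - z) := by
  have hz0 : z ≠ 0 := by rintro rfl; simp at hz1
  -- radial approach `r ↦ r z`, `r → 1⁻`
  have hφ : Tendsto (fun r : ℝ => (r : ℂ) * z) (𝓝[<] 1) (𝓝[Metric.closedBall 0 1] z) := by
    refine tendsto_nhdsWithin_iff.mpr ⟨?_, ?_⟩
    · have : Continuous fun r : ℝ => (r : ℂ) * z := by fun_prop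
      simpa using (this.tendsto 1).mono_left nhdsWithin_le_nhds
    · filter_upwards [Ioo_mem_nhdsLT zero_lt_one] with r hr
      simp [abs_of_pos hr.1, hz1, hr.2.le]
  have hlim1 : Tendsto (fun r : ℝ => (∑' n : ℕ, (((r : ℂ) * z) : ℂ) ^ (n + 1) * ((((1 : ℝ) / ((((n : ℕ) : ℝ) + 1) * (((n : ℕ) : ℝ) + 2)) : ℝ) : ℝ) : ℂ))) (𝓝[<] 1) (𝓝 ((∑' n : ℕ, ((z) : ℂ) ^ (n + 1) * ((((1 : ℝ) / ((((n : ℕ) : ℝ) + 1) * (((n : ℕ) : ℝ) + 2)) : ℝ) : ℝ) : ℂ)))) :=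
    (continuousOn_Fser.continuousWithinAt (by simp [hz1])).tendsto.comp hφ
  have hslit := one_sub_mem_slitPlane hz1.le hz
  have hlim2 : Tendsto (fun r : ℝ => 1 + (1 - (r : ℂ) * z) / ((r : ℂ) * z) * log (1 - (r : ℂ) * z))
      (𝓝[<] 1) (𝓝 (1 + (1 - z) / z * log (1 - z))) := by
    have hc : ContinuousAt
        (fun r : ℝ => 1 + (1 - (r : ℂ) * z) / ((r : ℂ) * z) * log (1 - (r : ℂ) * z)) 1 := by
      have h1 : ContinuousAt (fun r : ℝ => (r : ℂ) * z) 1 := by fun_prop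
      have h2 : ContinuousAt (fun r : ℝ => log (1 - (r : ℂ) * z)) 1 := by
        refine ContinuousAt.comp (g := log) ?_ (by fun_prop)
        simpa using continuousAt_clog hslit
      refine continuousAt_const.add (ContinuousAt.mul ?_ h2)
      exact (continuousAt_const.sub h1).div h1 (by simpa using hz0)
    simpa using hc.tendsto.mono_left nhdsWithin_le_nhds
  have heq : ∀ᶠ r : ℝ in 𝓝[<] 1,
      (∑' n : ℕ, (((r : ℂ) * z) : ℂ) ^ (n + 1) * ((((1 : ℝ) / ((((n : ℕ) : ℝ) + 1) * (((n : ℕ) : ℝ) + 2)) : ℝ) : ℝ) : ℂ)) = 1 + (1 - (r : ℂ) * z) / ((r : ℂ) * z) * log (1 - (r : ℂ) * z) := by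
    filter_upwards [Ioo_mem_nhdsLT zero_lt_one] with r hr
    have hn : ‖(r : ℂ) * z‖ < 1 := by simp [abs_of_pos hr.1, hz1, hr.2]
    have hn0 : (r : ℂ) * z ≠ 0 := mul_ne_zero (by exact_mod_cast hr.1.ne') hz0
    exact (hasSum_Fser_of_norm_lt_one hn hn0).tsum_eq
  exact tendsto_nhds_unique (hlim1.congr' heq) hlim2

/-! ### The series `T(z, σ) = ∑ G_{n+1}(z) ((n+1)^{-σ} - (n+2)^{-σ})` -/

/-- At `σ = 1` the weights differences are the `Fcoef`. [folklore] -/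
theorem rwt_one_sub (n : ℕ) : ((((n + 1 : ℕ) : ℝ) ^ (-(1 : ℝ)) : ℝ) : ℂ) - ((((n + 2 : ℕ) : ℝ) ^ (-(1 : ℝ)) : ℝ) : ℂ) = (((1 : ℝ) / ((((n : ℕ) : ℝ) + 1) * (((n : ℕ) : ℝ) + 2)) : ℝ) : ℂ) := by
  rw [Fcoef_eq_sub, Real.rpow_neg_one, Real.rpow_neg_one]
  push_cast
  ring

/-- **The value at `σ = 1`**: `T(z, 1) = -log(1 - z)` for `‖z‖ = 1`, `z ≠ 1`. [folklore] -/
theorem Tser_one {z : ℂ} (hz1 : ‖z‖ = 1) (hz : z ≠ 1) : (∑' n : ℕ, (∑ k ∈ Finset.range (n + 1), (z) ^ (k + 1)) * (((((n + 1 : ℕ) : ℝ) ^ (-(1 : ℝ)) : ℝ) : ℂ) - ((((n + 2 : ℕ) : ℝ) ^ (-(1 : ℝ)) : ℝ) : ℂ))) = -log (1 - z) := by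
  have hz0 : z ≠ 0 := by rintro rfl; simp at hz1
  have hz' : z - 1 ≠ 0 := sub_ne_zero.mpr hz
  have hsF : Summable fun n : ℕ => z ^ (n + 1) * (((1 : ℝ) / ((((n : ℕ) : ℝ) + 1) * (((n : ℕ) : ℝ) + 2)) : ℝ) : ℂ) :=
    .of_norm_bounded hasSum_Fcoef.summable (fun n => norm_Fser_term_le hz1.le n)
  have hsc : Summable fun n : ℕ => ((((1 : ℝ) / ((((n : ℕ) : ℝ) + 1) * (((n : ℕ) : ℝ) + 2)) : ℝ) : ℝ) : ℂ) := (Complex.hasSum_ofReal.mpr hasSum_Fcoef).summable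
  have hterm : ∀ n : ℕ, (∑ k ∈ Finset.range (n + 1), (z) ^ (k + 1)) * (((((n + 1 : ℕ) : ℝ) ^ (-(1 : ℝ)) : ℝ) : ℂ) - ((((n + 2 : ℕ) : ℝ) ^ (-(1 : ℝ)) : ℝ) : ℂ)) =
      z / (z - 1) * (z ^ (n + 1) * (((1 : ℝ) / ((((n : ℕ) : ℝ) + 1) * (((n : ℕ) : ℝ) + 2)) : ℝ) : ℂ) - (((1 : ℝ) / ((((n : ℕ) : ℝ) + 1) * (((n : ℕ) : ℝ) + 2)) : ℝ) : ℂ)) := by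
    intro n
    rw [rwt_one_sub, geomTail_eq z hz]
    field_simp
  rw [tsum_congr hterm, tsum_mul_left, hsF.tsum_sub hsc, (Complex.hasSum_ofReal.mpr hasSum_Fcoef).tsum_eq]
  change z / (z - 1) * ((∑' n : ℕ, ((z) : ℂ) ^ (n + 1) * ((((1 : ℝ) / ((((n : ℕ) : ℝ) + 1) * (((n : ℕ) : ℝ) + 2)) : ℝ) : ℝ) : ℂ)) - ((1 : ℝ) : ℂ)) = _
  rw [Fser_eq_of_norm_eq_one hz1 hz]
  push_cast
  field_simp
  ring


/-- Continuity of `σ ↦ k^{-σ}` (`k ≥ 1`). [folklore] -/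
theorem continuous_rwt (k : ℕ) (hk : k ≠ 0) : Continuous fun σ : ℝ => ((((k : ℕ) : ℝ) ^ (-(σ : ℝ)) : ℝ) : ℂ) := by
  have hk' : (k : ℝ) ≠ 0 := by exact_mod_cast hk
  have : Continuous fun σ : ℝ => (k : ℝ) ^ (-σ) :=
    (continuous_iff_continuousAt.2 fun x => Real.continuousAt_const_rpow hk').comp continuous_neg
  exact Complex.continuous_ofReal.comp this

/-- `‖k^{-σ}‖ ≤ 1/k` for `σ ≥ 1` (and both sides vanish at `k = 0`). [folklore] -/
theorem norm_rwt_le {σ : ℝ} (hσ : 1 ≤ σ) (k : ℕ) : ‖((((k : ℕ) : ℝ) ^ (-(σ : ℝ)) : ℝ) : ℂ)‖ ≤ 1 / k := by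
  rcases Nat.eq_zero_or_pos k with rfl | hk
  · simp [Real.zero_rpow (by linarith : (-σ : ℝ) ≠ 0)]
  · have hk' : (0 : ℝ) < k := by exact_mod_cast hk
    rw [Complex.norm_real, Real.norm_of_nonneg (Real.rpow_nonneg hk'.le _)]
    calc (k : ℝ) ^ (-σ) ≤ (k : ℝ) ^ (-1 : ℝ) :=
          Real.rpow_le_rpow_of_exponent_le (by exact_mod_cast hk) (by linarith)
      _ = 1 / k := by rw [Real.rpow_neg hk'.le, Real.rpow_one, one_div]

/-- Term bound for `T(z, σ)`, uniform in `σ ∈ [1, 2]`. [folklore] -/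
theorem norm_Tser_term_le {z : ℂ} (hz1 : ‖z‖ ≤ 1) (hz : z ≠ 1) {σ : ℝ} (hσ : σ ∈ Set.Icc (1 : ℝ) 2)
    (n : ℕ) :
    ‖(∑ k ∈ Finset.range (n + 1), (z) ^ (k + 1)) * (((((n + 1 : ℕ) : ℝ) ^ (-(σ : ℝ)) : ℝ) : ℂ) - ((((n + 2 : ℕ) : ℝ) ^ (-(σ : ℝ)) : ℝ) : ℂ))‖ ≤
      2 / ‖z - 1‖ * (2 / ((n : ℝ) + 1) ^ 2) := by
  rw [norm_mul]
  have h1 := norm_geomTail_le hz1 hz (n + 1)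
  have hcast : ((n : ℝ) + 1 + 1) = (n : ℝ) + 2 := by ring
  have h2 : ‖((((n + 1 : ℕ) : ℝ) ^ (-(σ : ℝ)) : ℝ) : ℂ) - ((((n + 2 : ℕ) : ℝ) ^ (-(σ : ℝ)) : ℝ) : ℂ)‖ ≤ 2 / ((n : ℝ) + 1) ^ 2 := by
    rw [← Complex.ofReal_sub, Complex.norm_real, Real.norm_of_nonneg]
    · have := rpow_neg_sub_succ_le_two_div_sq hσ (n + 1) (Nat.succ_pos n)
      push_cast at this ⊢
      rwa [hcast] at this
    · have := rpow_neg_sub_succ_nonneg (by linarith [hσ.1] : (0 : ℝ) ≤ σ)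
        (x := (n : ℝ) + 1) (by positivity)
      push_cast at this ⊢
      rwa [hcast] at this
  exact mul_le_mul h1 h2 (norm_nonneg _) (by positivity)

/-- The majorant `∑ 2/(n+1)²` converges. [folklore] -/
theorem summable_majorant : Summable fun n : ℕ => 2 / ((n : ℝ) + 1) ^ 2 := by
  have h : Summable fun n : ℕ => 1 / ((n + 1 : ℕ) : ℝ) ^ 2 :=
    (summable_nat_add_iff 1).mpr (Real.summable_one_div_nat_pow.mpr one_lt_two)
  refine (h.mul_left 2).congr fun n => ?_
  push_cast
  ring

/-- The terms of `T(z, σ)` are summable for `σ ∈ [1, 2]`. [folklore] -/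
theorem summable_Tser_term {z : ℂ} (hz1 : ‖z‖ ≤ 1) (hz : z ≠ 1) {σ : ℝ}
    (hσ : σ ∈ Set.Icc (1 : ℝ) 2) :
    Summable fun n : ℕ => (∑ k ∈ Finset.range (n + 1), (z) ^ (k + 1)) * (((((n + 1 : ℕ) : ℝ) ^ (-(σ : ℝ)) : ℝ) : ℂ) - ((((n + 2 : ℕ) : ℝ) ^ (-(σ : ℝ)) : ℝ) : ℂ)) :=
  .of_norm_bounded (summable_majorant.mul_left _) (norm_Tser_term_le hz1 hz hσ)

/-- `T(z, ·)` is continuous on `[1, 2]` (Weierstrass M-test). [folklore] -/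
theorem continuousOn_Tser {z : ℂ} (hz1 : ‖z‖ ≤ 1) (hz : z ≠ 1) :
    ContinuousOn (fun σ : ℝ => (∑' n : ℕ, (∑ k ∈ Finset.range (n + 1), (z) ^ (k + 1)) * (((((n + 1 : ℕ) : ℝ) ^ (-(σ : ℝ)) : ℝ) : ℂ) - ((((n + 2 : ℕ) : ℝ) ^ (-(σ : ℝ)) : ℝ) : ℂ)))) (Set.Icc 1 2) := by
  refine continuousOn_tsum (fun n => ?_) (summable_majorant.mul_left (2 / ‖z - 1‖))
    fun n σ hσ => norm_Tser_term_le hz1 hz hσ n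
  exact (continuous_const.mul ((continuous_rwt (n + 1) (Nat.succ_ne_zero n)).sub
    (continuous_rwt (n + 2) (Nat.succ_ne_zero _)))).continuousOn

/-- **Partial sums**: for `σ ∈ [1, 2]`, `∑_{n=1}^{M} zⁿ n^{-σ} → T(z, σ)` (Abel summation: the
boundary term `G_M M^{-σ}` tends to `0`). [folklore] -/
theorem tendsto_partial_sums {z : ℂ} (hz1 : ‖z‖ ≤ 1) (hz : z ≠ 1) {σ : ℝ}
    (hσ : σ ∈ Set.Icc (1 : ℝ) 2) :
    Tendsto (fun M : ℕ => ∑ n ∈ range M, z ^ (n + 1) * ((((n + 1 : ℕ) : ℝ) ^ (-(σ : ℝ)) : ℝ) : ℂ)) atTop (𝓝 ((∑' n : ℕ, (∑ k ∈ Finset.range (n + 1), (z) ^ (k + 1)) * (((((n + 1 : ℕ) : ℝ) ^ (-(σ : ℝ)) : ℝ) : ℂ) - ((((n + 2 : ℕ) : ℝ) ^ (-(σ : ℝ)) : ℝ) : ℂ))))) := by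
  have habel : ∀ M : ℕ, ∑ n ∈ range M, z ^ (n + 1) * ((((n + 1 : ℕ) : ℝ) ^ (-(σ : ℝ)) : ℝ) : ℂ) =
      (∑ k ∈ Finset.range (M), (z) ^ (k + 1)) * ((((M : ℕ) : ℝ) ^ (-(σ : ℝ)) : ℝ) : ℂ) + ∑ n ∈ range M, (∑ k ∈ Finset.range (n), (z) ^ (k + 1)) * (((((n : ℕ) : ℝ) ^ (-(σ : ℝ)) : ℝ) : ℂ) - ((((n + 1 : ℕ) : ℝ) ^ (-(σ : ℝ)) : ℝ) : ℂ)) :=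
    fun M => by
      have h := abel_summation z (fun k => ((((k : ℕ) : ℝ) ^ (-(σ : ℝ)) : ℝ) : ℂ)) M
      beta_reduce at h
      exact h
  simp_rw [habel]
  rw [← zero_add ((∑' n : ℕ, (∑ k ∈ Finset.range (n + 1), (z) ^ (k + 1)) * (((((n + 1 : ℕ) : ℝ) ^ (-(σ : ℝ)) : ℝ) : ℂ) - ((((n + 2 : ℕ) : ℝ) ^ (-(σ : ℝ)) : ℝ) : ℂ))))]
  refine Tendsto.add ?_ ?_
  · -- boundary term
    apply squeeze_zero_norm (a := fun M : ℕ => 2 / ‖z - 1‖ * (1 / (M : ℝ)))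
    · intro M
      rw [norm_mul]
      exact mul_le_mul (norm_geomTail_le hz1 hz M) (norm_rwt_le hσ.1 M) (norm_nonneg _)
        (by positivity)
    · simpa using (tendsto_const_div_atTop_nhds_zero_nat (1 : ℝ)).const_mul (2 / ‖z - 1‖)
  · -- the absolutely convergent part
    set t : ℕ → ℂ := fun n => (∑ k ∈ Finset.range (n), (z) ^ (k + 1)) * (((((n : ℕ) : ℝ) ^ (-(σ : ℝ)) : ℝ) : ℂ) - ((((n + 1 : ℕ) : ℝ) ^ (-(σ : ℝ)) : ℝ) : ℂ)) with ht
    have hs : Summable t := (summable_nat_add_iff 1).mp (summable_Tser_term hz1 hz hσ)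
    have h0 : t 0 = 0 := by simp [ht]
    have : (∑' n : ℕ, (∑ k ∈ Finset.range (n + 1), (z) ^ (k + 1)) * (((((n + 1 : ℕ) : ℝ) ^ (-(σ : ℝ)) : ℝ) : ℂ) - ((((n + 2 : ℕ) : ℝ) ^ (-(σ : ℝ)) : ℝ) : ℂ))) = ∑' n, t n := by
      rw [hs.tsum_eq_zero_add, h0, zero_add]
    rw [this]
    exact hs.hasSum.tendsto_sum_nat

/-- **`expZeta` for `σ > 1`**: `expZeta a σ = T(e^{2πia}, σ)` for `σ ∈ (1, 2]`, `e^{2πia} ≠ 1`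
(the Dirichlet series, Mathlib `hasSum_expZeta_of_one_lt_re`, rearranged by Abel summation).
[folklore] -/
theorem expZeta_eq_Tser (a : ℝ) (hz : cexp (2 * Real.pi * I * a) ≠ 1) {σ : ℝ}
    (hσ : σ ∈ Set.Ioc (1 : ℝ) 2) :
    HurwitzZeta.expZeta a σ = (∑' n : ℕ, (∑ k ∈ Finset.range (n + 1), (cexp (2 * Real.pi * I * a)) ^ (k + 1)) * (((((n + 1 : ℕ) : ℝ) ^ (-(σ : ℝ)) : ℝ) : ℂ) - ((((n + 2 : ℕ) : ℝ) ^ (-(σ : ℝ)) : ℝ) : ℂ))) := by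
  set z := cexp (2 * Real.pi * I * a) with hzdef
  have hz1 : ‖z‖ ≤ 1 := by
    rw [hzdef, show 2 * (Real.pi : ℂ) * I * a = ((2 * Real.pi * a : ℝ) : ℂ) * I by push_cast; ring,
      Complex.norm_exp_ofReal_mul_I]
  have hsum := HurwitzZeta.hasSum_expZeta_of_one_lt_re a (s := σ) (by simpa using hσ.1)
  have hσ0 : (σ : ℂ) ≠ 0 := by exact_mod_cast (by linarith [hσ.1] : σ ≠ 0)
  -- identify the shifted terms
  have hterm : ∀ n : ℕ, cexp (2 * Real.pi * I * a * ((n : ℂ) + 1)) / ((n : ℂ) + 1) ^ (σ : ℂ) =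
      z ^ (n + 1) * ((((n + 1 : ℕ) : ℝ) ^ (-(σ : ℝ)) : ℝ) : ℂ) := by
    intro n
    rw [show 2 * (Real.pi : ℂ) * I * a * ((n : ℂ) + 1) = ((n + 1 : ℕ) : ℂ) * (2 * Real.pi * I * a) by
      push_cast; ring, Complex.exp_nat_mul, ← hzdef]
    rw [Real.rpow_neg (by positivity), Complex.ofReal_inv, Complex.ofReal_cpow (by positivity),
      div_eq_mul_inv]
    push_cast
    rfl
  have h1 : Tendsto (fun M : ℕ => ∑ n ∈ range M, z ^ (n + 1) * ((((n + 1 : ℕ) : ℝ) ^ (-(σ : ℝ)) : ℝ) : ℂ)) atTop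
      (𝓝 (HurwitzZeta.expZeta a σ)) := by
    have := hsum.tendsto_sum_nat.comp (tendsto_add_atTop_nat 1)
    refine this.congr fun M => ?_
    simp only [Function.comp_apply]
    rw [sum_range_succ']
    have h0 : cexp (2 * Real.pi * I * a * ((0 : ℕ) : ℂ)) / ((0 : ℕ) : ℂ) ^ (σ : ℂ) = 0 := by
      simp [Complex.zero_cpow hσ0]
    rw [h0, add_zero]
    refine sum_congr rfl fun n _ => ?_
    rw [← hterm n]
    simp only [Nat.cast_add, Nat.cast_one]
  exact tendsto_nhds_unique h1 (tendsto_partial_sums hz1 hz ⟨hσ.1.le, hσ.2⟩)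

/-- **The boundary value** `∑_{n ≥ 1} e^{2πina}/n = expZeta a 1 = -log(1 - e^{2πia})` for
`e^{2πia} ≠ 1`: `σ ↦ expZeta a σ` and `T(z, ·)` are continuous on `[1, 2]` and agree on `(1, 2]`.
[folklore] -/
theorem expZeta_one (a : ℝ) (hz : cexp (2 * Real.pi * I * a) ≠ 1) :
    HurwitzZeta.expZeta a 1 = -log (1 - cexp (2 * Real.pi * I * a)) := by
  set z := cexp (2 * Real.pi * I * a) with hzdef
  have hz1 : ‖z‖ = 1 := by
    rw [hzdef, show 2 * (Real.pi : ℂ) * I * a = ((2 * Real.pi * a : ℝ) : ℂ) * I by push_cast; ring,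
      Complex.norm_exp_ofReal_mul_I]
  have ha : (a : UnitAddCircle) ≠ 0 := by
    intro h
    obtain ⟨k, hk⟩ := (AddCircle.coe_eq_zero_iff (1 : ℝ)).mp h
    apply hz
    rw [hzdef, ← hk]
    simp only [zsmul_eq_mul, mul_one]
    have : 2 * (Real.pi : ℂ) * I * ((k : ℝ) : ℂ) = k * (2 * Real.pi * I) := by push_cast; ring
    rw [this]
    exact Complex.exp_int_mul_two_pi_mul_I k
  have hcont : ContinuousOn (fun σ : ℝ => HurwitzZeta.expZeta a σ) (Set.Icc 1 2) :=
    ((HurwitzZeta.differentiable_expZeta_of_ne_zero ha).continuous.comp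
      Complex.continuous_ofReal).continuousOn
  have heq : Set.EqOn (fun σ : ℝ => HurwitzZeta.expZeta a σ) (fun σ : ℝ => (∑' n : ℕ, (∑ k ∈ Finset.range (n + 1), (z) ^ (k + 1)) * (((((n + 1 : ℕ) : ℝ) ^ (-(σ : ℝ)) : ℝ) : ℂ) - ((((n + 2 : ℕ) : ℝ) ^ (-(σ : ℝ)) : ℝ) : ℂ))))
      (Set.Ioc 1 2) :=
    fun σ hσ => expZeta_eq_Tser a hz hσ
  have heq' := heq.of_subset_closure hcont (continuousOn_Tser hz1.le hz) Set.Ioc_subset_Icc_self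
    (by rw [closure_Ioc (by norm_num : (1 : ℝ) ≠ 2)])
  have := heq' (Set.left_mem_Icc.mpr (by norm_num : (1 : ℝ) ≤ 2))
  simp only [Complex.ofReal_one] at this
  rw [this, Tser_one hz1 hz]


/-! ### `sinZeta a 1 = π (1/2 - a)` and `hurwitzZetaOdd a 0 = 1/2 - a` -/

/-- `1 - e^{2πia} = 2 sin(πa) · e^{i(πa - π/2)}`. [folklore] -/
theorem one_sub_exp_two_pi_mul_I (a : ℝ) :
    1 - cexp (2 * Real.pi * I * a) =
      ((2 * Real.sin (Real.pi * a) : ℝ) : ℂ) * cexp ((Real.pi * a - Real.pi / 2 : ℝ) * I) := by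
  rw [show 2 * (Real.pi : ℂ) * I * a = ((2 * (Real.pi * a) : ℝ) : ℂ) * I by push_cast; ring]
  have hc := Real.sin_sq_add_cos_sq (Real.pi * a)
  apply Complex.ext
  · rw [Complex.sub_re, Complex.one_re, Complex.exp_ofReal_mul_I_re, Complex.re_ofReal_mul,
      Complex.exp_ofReal_mul_I_re, Real.cos_sub_pi_div_two, Real.cos_two_mul]
    nlinarith [hc]
  · rw [Complex.sub_im, Complex.one_im, Complex.exp_ofReal_mul_I_im, Complex.im_ofReal_mul,
      Complex.exp_ofReal_mul_I_im, Real.sin_sub_pi_div_two, Real.sin_two_mul]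
    ring

/-- `arg (1 - e^{2πia}) = πa - π/2` for `0 < a < 1`. [folklore] -/
theorem arg_one_sub_exp {a : ℝ} (ha : a ∈ Set.Ioo (0 : ℝ) 1) :
    arg (1 - cexp (2 * Real.pi * I * a)) = Real.pi * a - Real.pi / 2 := by
  rw [one_sub_exp_two_pi_mul_I, Complex.arg_real_mul, Complex.exp_mul_I,
    Complex.arg_cos_add_sin_mul_I]
  · constructor <;> nlinarith [Real.pi_pos, ha.1, ha.2]
  · refine mul_pos two_pos (Real.sin_pos_of_pos_of_lt_pi (by nlinarith [Real.pi_pos, ha.1]) ?_)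
    nlinarith [Real.pi_pos, ha.2]

/-- `e^{2πia} ≠ 1` for `0 < a < 1`. [folklore] -/
theorem exp_two_pi_mul_I_ne_one {a : ℝ} (ha : a ∈ Set.Ioo (0 : ℝ) 1) :
    cexp (2 * Real.pi * I * a) ≠ 1 := by
  intro h
  have h2 : 1 - cexp (2 * Real.pi * I * a) = 0 := by rw [h, sub_self]
  rw [one_sub_exp_two_pi_mul_I, mul_eq_zero] at h2
  rcases h2 with h2 | h2
  · have : 0 < 2 * Real.sin (Real.pi * a) := by
      refine mul_pos two_pos (Real.sin_pos_of_pos_of_lt_pi (by nlinarith [Real.pi_pos, ha.1]) ?_)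
      nlinarith [Real.pi_pos, ha.2]
    exact this.ne' (by exact_mod_cast h2)
  · exact Complex.exp_ne_zero _ h2

/-- **`sinZeta a 1 = π (1/2 - a)`** for `0 < a < 1`: the conditionally convergent Fourier series
`∑ sin(2πna)/n = π(1/2 - a)`, obtained as `-Im log(1 - e^{2πia}) = -arg(1 - e^{2πia})`.
[folklore] -/
theorem sinZeta_one {a : ℝ} (ha : a ∈ Set.Ioo (0 : ℝ) 1) :
    HurwitzZeta.sinZeta a 1 = ((Real.pi * (1 / 2 - a) : ℝ) : ℂ) := by
  set z := cexp (2 * Real.pi * I * a) with hzdef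
  have hz : z ≠ 1 := exp_two_pi_mul_I_ne_one ha
  have hz1 : ‖z‖ = 1 := by
    rw [hzdef, show 2 * (Real.pi : ℂ) * I * a = ((2 * Real.pi * a : ℝ) : ℂ) * I by push_cast; ring,
      Complex.norm_exp_ofReal_mul_I]
  have hzinv : z⁻¹ = (starRingEnd ℂ) z := by
    rw [Complex.inv_def, Complex.normSq_eq_norm_sq, hz1]
    simp
  have hneg : cexp (2 * Real.pi * I * ((-a : ℝ) : ℂ)) = (starRingEnd ℂ) z := by
    rw [← hzinv, hzdef, ← Complex.exp_neg]
    push_cast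
    ring_nf
  have hneg1 : cexp (2 * Real.pi * I * ((-a : ℝ) : ℂ)) ≠ 1 := by
    rw [hneg]
    intro h
    apply hz
    simpa using congrArg (starRingEnd ℂ) h
  have hslit := one_sub_mem_slitPlane hz1.le hz
  have harg : (1 - z).arg ≠ Real.pi := (Complex.mem_slitPlane_iff_arg.mp hslit).1
  have e1 : HurwitzZeta.expZeta a 1 = -log (1 - z) := expZeta_one a hz
  have e2 : HurwitzZeta.expZeta (-(a : UnitAddCircle)) 1 = -(starRingEnd ℂ) (log (1 - z)) := by
    rw [← AddCircle.coe_neg, expZeta_one (-a) hneg1, hneg, ← Complex.log_conj _ harg, map_sub, map_one]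
  rw [HurwitzZeta.sinZeta_eq, e1, e2, show -log (1 - z) - -(starRingEnd ℂ) (log (1 - z)) =
    -(log (1 - z) - (starRingEnd ℂ) (log (1 - z))) by ring, Complex.sub_conj, Complex.log_im,
    hzdef, arg_one_sub_exp ha]
  have hI : (2 : ℂ) * I ≠ 0 := mul_ne_zero two_ne_zero Complex.I_ne_zero
  field_simp
  push_cast
  ring

/-- **`hurwitzZetaOdd a 0 = 1/2 - a`** for `0 < a < 1` (functional equation
`hurwitzZetaOdd_one_sub` at `s = 1` and `sinZeta_one`). This is the `k = 0` case left as a TODO in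
Mathlib's `hurwitzZeta_neg_nat`. [folklore] -/
theorem hurwitzZetaOdd_zero {a : ℝ} (ha : a ∈ Set.Ioo (0 : ℝ) 1) :
    HurwitzZeta.hurwitzZetaOdd a 0 = 1 / 2 - (a : ℂ) := by
  have h := HurwitzZeta.hurwitzZetaOdd_one_sub (a : UnitAddCircle) (s := 1) (fun n => by
    intro h
    have := congrArg Complex.re h
    simp at this
    linarith)
  rw [sub_self, sinZeta_one ha, Complex.Gamma_one, Complex.cpow_neg_one,
    show (Real.pi : ℂ) * 1 / 2 = Real.pi / 2 by ring, Complex.sin_pi_div_two] at h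
  rw [h]
  push_cast
  field_simp

/-- `hurwitzZetaOdd 0 s = 0` (oddness). [folklore] -/
theorem hurwitzZetaOdd_zero_left (s : ℂ) : HurwitzZeta.hurwitzZetaOdd 0 s = 0 := by
  have := HurwitzZeta.hurwitzZetaOdd_neg 0 s
  rw [neg_zero] at this
  exact self_eq_neg.mp this

/-! ### `L(χ, 0) = -B_{1,χ}` for odd `χ`, and its non-vanishing for odd primitive `χ` -/

/-- An odd character has level `≠ 1`. [folklore] -/
theorem level_ne_one_of_odd {N : ℕ} {χ : DirichletCharacter ℂ N} (hχ : χ.Odd) : N ≠ 1 := by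
  rintro rfl
  have h1 : χ = 1 := χ.level_one' rfl
  rw [DirichletCharacter.Odd, h1] at hχ
  have : (1 : DirichletCharacter ℂ 1) (-1) = 1 := MulChar.one_apply isUnit_one.neg
  rw [this] at hχ
  norm_num at hχ

/-- An odd character is non-trivial. [folklore] -/
theorem ne_one_of_odd {N : ℕ} [NeZero N] {χ : DirichletCharacter ℂ N} (hχ : χ.Odd) : χ ≠ 1 := by
  intro h1
  rw [DirichletCharacter.Odd, h1, MulChar.one_apply isUnit_one.neg] at hχ
  norm_num at hχ

/-- **`L(χ, 0) = -(1/N) ∑_{j mod N} χ(j) j = -B_{1,χ}`** for an odd Dirichlet character `χ` mod `N`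
(from `L(χ, s) = N^{-s} ∑ χ(j) ζ_odd(j/N, s)` and `ζ_odd(x, 0) = 1/2 - x`). [folklore] -/
theorem LFunction_apply_zero_of_odd {N : ℕ} [NeZero N] {χ : DirichletCharacter ℂ N} (hχ : χ.Odd) :
    χ.LFunction 0 = -(1 / N) * ∑ j : ZMod N, χ j * (j.val : ℂ) := by
  have hN1 := level_ne_one_of_odd hχ
  have hN : (0 : ℝ) < N := by exact_mod_cast Nat.pos_of_ne_zero (NeZero.ne N)
  have hterm : ∀ j : ZMod N, χ j * HurwitzZeta.hurwitzZetaOdd (ZMod.toAddCircle j) 0 =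
      χ j * (1 / 2 - (j.val : ℂ) / N) := by
    intro j
    by_cases hj : j = 0
    · subst hj
      rw [χ.map_zero' hN1, zero_mul, zero_mul]
    · rw [ZMod.toAddCircle_apply]
      have hj' : ((j.val : ℝ) / N) ∈ Set.Ioo (0 : ℝ) 1 := by
        constructor
        · exact div_pos (by exact_mod_cast Nat.pos_of_ne_zero ((ZMod.val_ne_zero j).mpr hj)) hN
        · rw [div_lt_one hN]; exact_mod_cast ZMod.val_lt j
      rw [hurwitzZetaOdd_zero hj']
      push_cast
      ring
  rw [DirichletCharacter.LFunction, ZMod.LFunction_def_odd hχ.to_fun, neg_zero, Complex.cpow_zero,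
    one_mul, Finset.sum_congr rfl fun j _ => hterm j]
  have hsum : ∑ j : ZMod N, χ j = 0 := χ.sum_eq_zero_of_ne_one (ne_one_of_odd hχ)
  have : ∑ j : ZMod N, χ j * (1 / 2 - (j.val : ℂ) / N) =
      (1 / 2) * ∑ j : ZMod N, χ j - (1 / N) * ∑ j : ZMod N, χ j * (j.val : ℂ) := by
    rw [Finset.mul_sum, Finset.mul_sum, ← Finset.sum_sub_distrib]
    refine Finset.sum_congr rfl fun j _ => ?_
    ring
  rw [this, hsum]
  ring

/-- **`L(χ, 0) ≠ 0` for an odd primitive character** (functional equation at `s = 1`: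
`Λ(χ, 0) = N^{1/2} ε(χ) Λ(χ⁻¹, 1)` with `L(χ⁻¹, 1) ≠ 0`, `ε(χ) ≠ 0`, and `γ(χ, 0) = Γ_ℝ(1) = 1`).
[folklore] -/
theorem LFunction_apply_zero_ne_zero {N : ℕ} [NeZero N] {χ : DirichletCharacter ℂ N}
    (hχ : χ.Odd) (hprim : χ.IsPrimitive) : χ.LFunction 0 ≠ 0 := by
  have hN1 := level_ne_one_of_odd hχ
  have hχ1 := ne_one_of_odd hχ
  have hinv1 : χ⁻¹ ≠ 1 := inv_ne_one.mpr hχ1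
  -- `ε(χ) ≠ 0`: otherwise the functional equation forces `Λ(·, χ) ≡ 0`, contradicting
  -- `L(2, χ) ≠ 0` (as in `Literature.NumberTheory.LFunctions.AutomorphicGRHOne.rootNumber_ne_zero`,
  -- re-proved here to keep the imports of this file minimal).
  have hε : χ.rootNumber ≠ 0 := by
    intro h0
    have hΛ : ∀ s, χ.completedLFunction s = 0 := by
      intro s
      have := hprim.completedLFunction_one_sub (1 - s)
      rw [sub_sub_cancel, h0, mul_zero, zero_mul] at this
      exact this
    have h2 : χ.LFunction 2 = 0 := by
      rw [DirichletCharacter.LFunction_eq_completed_div_gammaFactor χ 2 (Or.inr hN1), hΛ, zero_div]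
    exact DirichletCharacter.LFunction_ne_zero_of_one_le_re χ (Or.inl hχ1) (by norm_num) h2
  have hΛ1 : χ⁻¹.completedLFunction 1 ≠ 0 := by
    intro h
    have := DirichletCharacter.LFunction_eq_completed_div_gammaFactor χ⁻¹ 1 (Or.inl one_ne_zero)
    rw [h, zero_div] at this
    exact DirichletCharacter.LFunction_apply_one_ne_zero hinv1 this
  have hFE := hprim.completedLFunction_one_sub 1
  rw [sub_self] at hFE
  have hΛ0 : χ.completedLFunction 0 ≠ 0 := by
    rw [hFE]
    refine mul_ne_zero (mul_ne_zero ?_ hε) hΛ1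
    exact Complex.cpow_ne_zero_iff.mpr (Or.inl (by exact_mod_cast NeZero.ne N))
  rw [DirichletCharacter.LFunction_eq_completed_div_gammaFactor χ 0 (Or.inr hN1), hχ.gammaFactor_def,
    zero_add, Complex.Gammaℝ_one, div_one]
  exact hΛ0

/-- **`B_{1,χ} ≠ 0` for odd primitive `χ`**: `∑_{j mod N} χ(j) j ≠ 0`. This is the arithmetic
input (`L(1, χ̄) ≠ 0`) of the Koblitz–Ogus / Kubert–Lang argument. [folklore] -/
theorem sum_char_mul_val_ne_zero {N : ℕ} [NeZero N] {χ : DirichletCharacter ℂ N}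
    (hχ : χ.Odd) (hprim : χ.IsPrimitive) : ∑ j : ZMod N, χ j * (j.val : ℂ) ≠ 0 := by
  intro h
  apply LFunction_apply_zero_ne_zero hχ hprim
  rw [LFunction_apply_zero_of_odd hχ, h, mul_zero]

end KoblitzOgus

end Literature.NumberTheory.Transcendental
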